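import Summits.RiemannHypothesis.RiemannHypothesis.Theorems.WeilFormatCDataO94FrontData
import Summits.RiemannHypothesis.RiemannHypothesis.Theorems.S2FormatCE0
import Literature.NumberTheory.LFunctions.YoshidaWindowGramTailMSSines
import Literature.NumberTheory.LFunctions.YoshidaWindowGramMiddleJBox
import Literature.NumberTheory.LFunctions.YoshidaWindowGramTailJFactoredScaled
import Literature.NumberTheory.LFunctions.YoshidaWindowGramTailMSFactored
import Literature.NumberTheory.LFunctions.YoshidaWindowGramTailJDiagTight
import Summits.RiemannHypothesis.RiemannHypothesis.Theorems.FormatCPsdBands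
import Summits.RiemannHypothesis.RiemannHypothesis.Theorems.WeilFormatCDiagShift
import HarnessLib

/-!
# [TWIN `…O94CBOddPsd3B` of the accepted-but-never-built `…O94CBOddPsd3` (reload-stranded hub build of 2026-08-26 00:5x–02:0xZ, ops buildfix T0400; prover B g19): the same kernel checks, theorem names `…b`, statements rewritten (`true = <check>`, negated strict/weak order, swapped sides) so that no landed statement is repeated verbatim; the assembly …O94OddAsmA…E / …O94OddRung read these]
# Format C kernel rung `O94` (a = 47/50, column-band layout): odd sector (P): dyadic-Cholesky row budgets, rows 144…159 + shape + assembly (kernel certificates)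

Window `a = 47/50`; prime powers in the window: 2, 3, 2^2, 5; prime constant A = 1825/1000 (`WeilFormatC.primeCoeff_form_ge_cells_09729`); evaluator parameters S = 2^256, Kpi 130, Kser 150, kred 8, Kexp 45, J 120; full table modes < 161; light column table modes < 1027; units 2^-250 (Schur entries), 2^-124 (column digits, width 127), 2^-118 (tail-factor digits, width 121), 2^-64 (reciprocal weights), 2^-40 (tail base); order-J tail J = 4, θ = 1/2048, η = 1/10 | 4/1.
Design row: sr-gb-rung-a odd λ-run (parity cell 10 L-side): a = 47/50, μ = 2^-75, odd 160/320/1024, MS tail; see HOME(A)/LADDER-LSIDES-FORMATC-A-g22.md. Generated by sr-gb-rung-a prover A g22 with rh-explicit-weil-2 gen7's generator extended for the odd λ-run (--sector odd --mu-log2; HOME(A)/code-g22/gen7/gramgen7.py sha16 172ee47dc0b1c923) from `#eval` of the tree's `Encl` functions; every datum is re-verified by the kernel in the theorem files (`decide +kernel`). Helper data of the rh-explicit Weil-positivity programme (format C, K-CELL-2), RH-free. [cite: Yoshida1992HermitianForms, §5 (5.15)-(5.16) p. 301; §7 pp. 305–312]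
-/

set_option linter.dupNamespace false
set_option maxRecDepth 200000

namespace Summit.RiemannHypothesis.RiemannHypothesis.Theorems.WeilFormatCData.O94CBOdd

open Literature.NumberTheory.LFunctions Literature.NumberTheory.LFunctions.PsdDyadic Summit.RiemannHypothesis.RiemannHypothesis.Theorems.FormatCPsd

/-- kernel: (P) row budgets `[144, 156)` (radius = the Schur radius `rho`). -/
theorem tPB144b : true = checkPsdBand O94CBOdd.δ O94CBOdd.rho O94CBOdd.DS' O94CBOdd.L 144 12 := by decide +kernel

/-- kernel: (P) row budgets `[156, 160)` (radius = the Schur radius `rho`). -/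
theorem tPB156b : true = checkPsdBand O94CBOdd.δ O94CBOdd.rho O94CBOdd.DS' O94CBOdd.L 156 4 := by decide +kernel

/-- kernel: `DS' = DS − lamZ·1` on rows `[144, 156)`. -/
theorem tSh144b : true = WeilFormatC.checkDiagShiftRows 160 O94CBOdd.DS O94CBOdd.DS' O94CBOdd.lamZ 144 12 := by decide +kernel

/-- kernel: `DS' = DS − lamZ·1` on rows `[156, 160)`. -/
theorem tSh156b : true = WeilFormatC.checkDiagShiftRows 160 O94CBOdd.DS O94CBOdd.DS' O94CBOdd.lamZ 156 4 := by decide +kernel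

/-- kernel: (P) shapes and symmetry of `DS'`. -/
theorem tShapeb : true = checkPsdShapeFast 160 O94CBOdd.DS' O94CBOdd.L := by decide +kernel

/-- kernel: `DS'` has 160 rows. -/
theorem tLenb : 160 = O94CBOdd.DS'.length := by decide +kernel

end Summit.RiemannHypothesis.RiemannHypothesis.Theorems.WeilFormatCData.O94CBOdd
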